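import Literature.Probability.Percolation.ZdFiveArmSepEInwardExt
import HarnessLib

/-!
# Inward extension of Kesten's well-separated five-arm event `zdFiveArmSepE` (bond percolation on `ℤ²`), probabilistic half

Topic `Literature/Probability/Percolation`; critical bond percolation on `ℤ²`
(`bondPercolation (zdGraph 2) half`). PROOFS ONLY (no definition, no named fact).

The input `(ext)` of `DuminilCopinManolescuTassion2021_zdFiveArm_upperBound_of_separationInputs`
(`ZdFiveArmUpperBoundOfScheme.lean`):

  `∃ C₀ ≥ 1, P_{1/2}(zdFiveArmSepE m N) ≤ C₀ · P_{1/2}(zdFiveArmSepE m' N)`   (`64 ≤ m'`, `2m' ≤ m ≤ 4m'`, `2m ≤ N`),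

following `ZdFourArmSepInwardExtProb.lean` verbatim (Nolin 2008, §4.3 Prop. 12 (i) and Lemma 13;
Kesten 1987, Lemma 5, (2.43)): the generalised FKG inequality
`bondPercolation_locallyMonotone_fkg` with the common class the pairs of the zones of the fully
fenced event, the increasing class the open extension pairs — those of the four-arm file together
with the pairs `inwardRpPairs`, `inwardRmPairs` of the two bent right-arm extensions (sites in the
columns `[m' - m'/8 + 1, m - 1]` and the rows `|x₁| ≤ m/4 + m/64`, off the top/bottom zones) — and
the decreasing class the dual extension pairs; RSW at aspect ratio `256` bounds the twenty-eight
extension events below; the deterministic half is `mem_zdFiveArmSepE_of_mem_inward5`.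

* `inwardRpPairs_sites`, `inwardRmPairs_sites`, `notMem_zoneTB_of_extSite`, `disjoint_inward5Pairs`;
* `le_real_inwardRpEvents`, `le_real_inwardRmEvents` (`≥ c⁶` each);
* `real_zdFiveArmSepE_inter_inward_ge`, **`real_zdFiveArmSepE_inward_ge`**,
  **`exists_real_zdFiveArmSepE_le_mul_inward`**.

## References

* P. Nolin, *Near-critical percolation in two dimensions*, EJP 13 (2008), §4.3 Prop. 12 (i) and
  Lemma 13, §4.4 part 2 [arXiv 0711.4948: Prop. 11 (i), Lemma 12, p. 13]. [Nolin2008]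
* H. Kesten, *Scaling relations for 2D-percolation*, CMP 109 (1987), §2, Lemma 5, (2.43).
  [KestenScalingCMP1987]
* B. Bollobás, O. Riordan, *Percolation* (2006), Ch. 3, eq. (3) (RSW). [BollobasRiordan2006]
-/

noncomputable section

open MeasureTheory Set SimpleGraph

namespace Literature.Probability.Percolation

open LatticeModels

/-! ### Sites of the right-arm extension pairs -/

section Pairs

variable {m m' : ℕ}

/-- Corridor sizes of the extension (copy of the private lemma of the deterministic file). [folklore] -/
private theorem ext_arith' (hm' : 64 ≤ m') (h2 : 2 * m' ≤ m) :
    ((m' / 2 - m' / 4 : ℕ) : ℤ) = (m' / 2 : ℕ) - (m' / 4 : ℕ) ∧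
    ((m - 1 - m' - m' / 4 : ℕ) : ℤ) = (m : ℤ) - 1 - m' - (m' / 4 : ℕ) ∧
    ((m' / 8 - 1 + m' / 16 : ℕ) : ℤ) = (m' / 8 : ℕ) - 1 + (m' / 16 : ℕ) ∧
    ((m' / 16 - 1 : ℕ) : ℤ) = (m' / 16 : ℕ) - 1 ∧ ((m' / 8 - 2 : ℕ) : ℤ) = (m' / 8 : ℕ) - 2 := by
  refine ⟨by omega, by omega, by omega, by omega, by omega⟩

/-- Arithmetic of the extension rows. [folklore] -/
private theorem rows_arith (hm' : 64 ≤ m') (h2 : 2 * m' ≤ m) :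
    ((((m / 4 : ℕ) : ℤ) + ((m / 64 : ℕ) : ℤ) - (((m' / 4 : ℕ) : ℤ) - ((m' / 64 : ℕ) : ℤ))).toNat : ℤ) =
        ((m / 4 : ℕ) : ℤ) + ((m / 64 : ℕ) : ℤ) - (((m' / 4 : ℕ) : ℤ) - ((m' / 64 : ℕ) : ℤ)) ∧
      (((-(((m' / 4 : ℕ) : ℤ) + ((m' / 64 : ℕ) : ℤ)) + 2 * ((m' / 64 : ℕ) : ℤ)) -
          (-(((m / 4 : ℕ) : ℤ) + ((m / 64 : ℕ) : ℤ)))).toNat : ℤ) =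
        (-(((m' / 4 : ℕ) : ℤ) + ((m' / 64 : ℕ) : ℤ)) + 2 * ((m' / 64 : ℕ) : ℤ)) - (-(((m / 4 : ℕ) : ℤ) + ((m / 64 : ℕ) : ℤ))) ∧
      ((m' / 4 : ℕ) : ℤ) + 2 * ((m' / 64 : ℕ) : ℤ) ≤ ((m / 4 : ℕ) : ℤ) + ((m / 64 : ℕ) : ℤ) ∧
      1 ≤ ((m' / 4 : ℕ) : ℤ) - ((m' / 64 : ℕ) : ℤ) ∧
      ((m' / 4 : ℕ) : ℤ) ≤ (m / 4 : ℕ) ∧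
      ((m' / 2 : ℕ) : ℤ) + (m' / 8 : ℕ) + 2 ≤ m' ∧ ((m' / 16 : ℕ) : ℤ) + 1 ≤ (m' / 8 : ℕ) := by
  have h1 : m' / 4 + 2 * (m' / 64) ≤ m / 4 + m / 64 := by omega
  have h1' : ((m' / 4 : ℕ) : ℤ) + 2 * ((m' / 64 : ℕ) : ℤ) ≤ ((m / 4 : ℕ) : ℤ) + ((m / 64 : ℕ) : ℤ) := by exact_mod_cast h1
  have h3 : m' / 64 + 1 ≤ m' / 4 := by omega
  have h3' : ((m' / 64 : ℕ) : ℤ) + 1 ≤ (m' / 4 : ℕ) := by exact_mod_cast h3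
  have h5 : m' / 2 + m' / 8 + 2 ≤ m' := by omega
  have h5' : ((m' / 2 : ℕ) : ℤ) + (m' / 8 : ℕ) + 2 ≤ m' := by exact_mod_cast h5
  have h6 : m' / 16 + 1 ≤ m' / 8 := by omega
  have h6' : ((m' / 16 : ℕ) : ℤ) + 1 ≤ (m' / 8 : ℕ) := by exact_mod_cast h6
  have h7 : m' / 4 ≤ m / 4 := by omega
  have h7' : ((m' / 4 : ℕ) : ℤ) ≤ (m / 4 : ℕ) := by exact_mod_cast h7
  have h0c : (0 : ℤ) ≤ (m' / 64 : ℕ) := by positivity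
  exact ⟨Int.toNat_of_nonneg (by linarith), Int.toNat_of_nonneg (by linarith), h1', by linarith, h7', h5', h6'⟩

set_option maxHeartbeats 1600000 in
/-- **Sites of the `R⁺` extension pairs**: columns `[m' - m'/8 + 1, m - 1]`, rows
`[m'/4 - m'/64, m/4 + m/64]`. [folklore] -/
theorem inwardRpPairs_sites (hm' : 64 ≤ m') (h2 : 2 * m' ≤ m) {e : Sym2 (Site 2)}
    (he : e ∈ inwardRpPairs m m') {x : Site 2} (hx : x ∈ e) :
    (m' : ℤ) - (m' / 8 : ℕ) + 1 ≤ x 0 ∧ x 0 + 1 ≤ m ∧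
      ((m' / 4 : ℕ) : ℤ) - ((m' / 64 : ℕ) : ℤ) ≤ x 1 ∧ x 1 ≤ ((m / 4 : ℕ) : ℤ) + ((m / 64 : ℕ) : ℤ) := by
  obtain ⟨e1, -, e2, e4, e7, g1, g2⟩ := rows_arith hm' h2
  obtain ⟨f1, f2, f3, f4, f5⟩ := ext_arith' hm' h2
  have h0a : (0 : ℤ) ≤ (m / 64 : ℕ) := by positivity
  have h0c : (0 : ℤ) ≤ (m' / 64 : ℕ) := by positivity
  have hm'm : 2 * (m' : ℤ) ≤ m := by exact_mod_cast h2
  simp only [inwardRpPairs, Finset.mem_union] at he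
  rcases he with he | he | he | he | he | he <;>
    have h := apply_le_of_mem_rectanglePairs he hx <;>
    simp only [Matrix.cons_val_zero, Matrix.cons_val_one, Nat.cast_mul, Nat.cast_ofNat] at h
  · obtain ⟨a, b, c, d⟩ := h; exact ⟨by linarith, by linarith, by linarith, by linarith⟩
  · rw [e1, f1] at h; obtain ⟨a, b, c, d⟩ := h; exact ⟨by linarith, by linarith, by linarith, by linarith⟩
  · rw [f2] at h; obtain ⟨a, b, c, d⟩ := h; exact ⟨by linarith, by linarith, by linarith, by linarith⟩
  · rw [f3] at h; obtain ⟨a, b, c, d⟩ := h; exact ⟨by linarith, by linarith, by linarith, by linarith⟩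
  · rw [f4] at h; obtain ⟨a, b, c, d⟩ := h; exact ⟨by linarith, by linarith, by linarith, by linarith⟩
  · rw [f5] at h; obtain ⟨a, b, c, d⟩ := h; exact ⟨by linarith, by linarith, by linarith, by linarith⟩

set_option maxHeartbeats 1600000 in
/-- **Sites of the `R⁻` extension pairs**: columns `[m' - m'/8 + 1, m - 1]`, rows
`[-(m/4 + m/64), -(m'/4 + m'/64) + 2·m'/64]`. [folklore] -/
theorem inwardRmPairs_sites (hm' : 64 ≤ m') (h2 : 2 * m' ≤ m) {e : Sym2 (Site 2)}
    (he : e ∈ inwardRmPairs m m') {x : Site 2} (hx : x ∈ e) :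
    (m' : ℤ) - (m' / 8 : ℕ) + 1 ≤ x 0 ∧ x 0 + 1 ≤ m ∧
      -(((m / 4 : ℕ) : ℤ) + ((m / 64 : ℕ) : ℤ)) ≤ x 1 ∧
        x 1 ≤ -(((m' / 4 : ℕ) : ℤ) + ((m' / 64 : ℕ) : ℤ)) + 2 * ((m' / 64 : ℕ) : ℤ) := by
  obtain ⟨-, e1, e2, e4, e7, g1, g2⟩ := rows_arith hm' h2
  obtain ⟨f1, f2, f3, f4, f5⟩ := ext_arith' hm' h2
  have h0a : (0 : ℤ) ≤ (m / 64 : ℕ) := by positivity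
  have h0c : (0 : ℤ) ≤ (m' / 64 : ℕ) := by positivity
  have hm'm : 2 * (m' : ℤ) ≤ m := by exact_mod_cast h2
  simp only [inwardRmPairs, Finset.mem_union] at he
  rcases he with he | he | he | he | he | he <;>
    have h := apply_le_of_mem_rectanglePairs he hx <;>
    simp only [Matrix.cons_val_zero, Matrix.cons_val_one, Nat.cast_mul, Nat.cast_ofNat] at h
  · obtain ⟨a, b, c, d⟩ := h; exact ⟨by linarith, by linarith, by linarith, by linarith⟩
  · rw [e1, f1] at h; obtain ⟨a, b, c, d⟩ := h; exact ⟨by linarith, by linarith, by linarith, by linarith⟩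
  · rw [f2] at h; obtain ⟨a, b, c, d⟩ := h; exact ⟨by linarith, by linarith, by linarith, by linarith⟩
  · rw [f3] at h; obtain ⟨a, b, c, d⟩ := h; exact ⟨by linarith, by linarith, by linarith, by linarith⟩
  · rw [f4] at h; obtain ⟨a, b, c, d⟩ := h; exact ⟨by linarith, by linarith, by linarith, by linarith⟩
  · rw [f5] at h; obtain ⟨a, b, c, d⟩ := h; exact ⟨by linarith, by linarith, by linarith, by linarith⟩

/-- **A site of a right-arm extension pair lies in no top/bottom zone** of the fenced event of
`A_{m,N}`: columns `≥ m' - m'/8 + 1 > m/64 + m/8 + 1`, rows `|x₁| ≤ m/4 + m/64 < m - 1 - m/8`.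
[folklore] -/
theorem notMem_zoneTB_of_extSite {N : ℕ} (hm' : 64 ≤ m') (h2 : 2 * m' ≤ m) (h4 : m ≤ 4 * m') (hN : 2 * m ≤ N)
    {x : Site 2} (hx : (m' : ℤ) - (m' / 8 : ℕ) + 1 ≤ x 0 ∧ x 0 + 1 ≤ m ∧
      |x 1| ≤ ((m / 4 : ℕ) : ℤ) + ((m / 64 : ℕ) : ℤ)) :
    x ∉ zdSepZoneT m N ∪ zdSepZoneB m N := by
  obtain ⟨hx0, hx0', hx1⟩ := hx
  have a1 := abs_le.1 hx1
  have e1 : m / 64 + m / 8 + 1 + m' / 8 < m' := by omega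
  have e1' : ((m / 64 : ℕ) : ℤ) + (m / 8 : ℕ) + 1 + (m' / 8 : ℕ) < m' := by exact_mod_cast e1
  have e2 : m / 4 + m / 64 + 1 + m / 8 + 1 < m := by omega
  have e2' : ((m / 4 : ℕ) : ℤ) + (m / 64 : ℕ) + 1 + (m / 8 : ℕ) + 1 < m := by exact_mod_cast e2
  have e3 : m / 4 + m / 64 + N / 8 < N := by omega
  have e3' : ((m / 4 : ℕ) : ℤ) + (m / 64 : ℕ) + (N / 8 : ℕ) < N := by exact_mod_cast e3
  have e5 : (m' : ℤ) ≤ m := by exact_mod_cast (by omega : m' ≤ m)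
  have hm1 : 1 ≤ m := by omega
  rintro (h | h)
  · rcases h with h | ⟨h0, h0', h1, h1'⟩ | ⟨h0, h0', h1, h1'⟩
    · obtain ⟨-, -, hbig⟩ := coords_of_mem_sqAnnulus hm1 h
      rcases hbig with hb | hb | hb | hb <;> linarith
    · linarith
    · linarith
  · rcases h with h | ⟨h0, h0', h1, h1'⟩ | ⟨h0, h0', h1, h1'⟩
    · obtain ⟨-, -, hbig⟩ := coords_of_mem_sqAnnulus hm1 h
      rcases hbig with hb | hb | hb | hb <;> linarith
    · linarith
    · linarith

/-- The increasing extension pairs and the dual extension pairs are disjoint. [folklore] -/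
theorem disjoint_inward5Pairs (hm' : 64 ≤ m') (h2 : 2 * m' ≤ m) :
    Disjoint (inwardOpenPairs m m' ∪ (inwardRpPairs m m' ∪ inwardRmPairs m m')) (inwardDualPairs m m') := by
  rw [Finset.disjoint_left]
  intro e heP heM
  obtain ⟨x, hx⟩ : ∃ x, x ∈ e := ⟨e.out.1, Sym2.out_fst_mem e⟩
  have h2' := inwardDualPairs_sites hm' h2 heM hx
  have a0 := abs_le.1 h2'.1
  have e1 : 2 * (m' / 64) + 1 + m' / 8 < m' := by omega
  have e1' : 2 * ((m' / 64 : ℕ) : ℤ) + 1 + (m' / 8 : ℕ) < m' := by exact_mod_cast e1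
  rw [Finset.mem_union, Finset.mem_union] at heP
  rcases heP with heP | heP | heP
  · exact Finset.disjoint_left.1 (disjoint_inwardPairs hm' h2) heP heM
  · have h1 := (inwardRpPairs_sites hm' h2 heP hx).1; linarith
  · have h1 := (inwardRmPairs_sites hm' h2 heP hx).1; linarith

end Pairs

/-! ### RSW and Harris for the right-arm extension events -/

section RSW

variable {m m' : ℕ} {c : ℝ}

/-- The open extension events of the four-arm file are measurable. [folklore] -/
theorem measurableSet_inwardOpenEvents (m m' : ℕ) : MeasurableSet (inwardOpenEvents m m') := by
  unfold inwardOpenEvents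
  exact (((measurableSet_lrCrossingAt _ _ _).inter (measurableSet_lrCrossingAt _ _ _)).inter
    ((measurableSet_tbCrossingAt' _ _ _).inter (measurableSet_tbCrossingAt' _ _ _))).inter
    (((measurableSet_lrCrossingAt _ _ _).inter (measurableSet_lrCrossingAt _ _ _)).inter
      ((measurableSet_tbCrossingAt' _ _ _).inter (measurableSet_tbCrossingAt' _ _ _)))

/-- Six-fold Harris for increasing events with a common lower bound. [folklore] -/
theorem le_real_inter6_of_upper {E₁ E₂ E₃ E₄ E₅ E₆ : Set (BondConfig (Site 2))} {c : ℝ} (hc0 : 0 ≤ c)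
    (u₁ : IsUpperSet E₁) (u₂ : IsUpperSet E₂) (u₃ : IsUpperSet E₃) (u₄ : IsUpperSet E₄) (u₅ : IsUpperSet E₅)
    (u₆ : IsUpperSet E₆)
    (m₁ : MeasurableSet E₁) (m₂ : MeasurableSet E₂) (m₃ : MeasurableSet E₃) (m₄ : MeasurableSet E₄)
    (m₅ : MeasurableSet E₅) (m₆ : MeasurableSet E₆)
    (h₁ : c ≤ (bondPercolation (zdGraph 2) half).real E₁) (h₂ : c ≤ (bondPercolation (zdGraph 2) half).real E₂)
    (h₃ : c ≤ (bondPercolation (zdGraph 2) half).real E₃) (h₄ : c ≤ (bondPercolation (zdGraph 2) half).real E₄)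
    (h₅ : c ≤ (bondPercolation (zdGraph 2) half).real E₅) (h₆ : c ≤ (bondPercolation (zdGraph 2) half).real E₆) :
    c ^ 6 ≤ (bondPercolation (zdGraph 2) half).real (E₁ ∩ (E₂ ∩ (E₃ ∩ (E₄ ∩ (E₅ ∩ E₆))))) := by
  have e : c ^ 6 = c * (c * (c * (c * (c * c)))) := by ring
  rw [e]
  have s₅ := le_real_inter_of_upper hc0 hc0 u₅ u₆ m₅ m₆ h₅ h₆
  have s₄ := le_real_inter_of_upper hc0 (by positivity) u₄ (u₅.inter u₆) m₄ (m₅.inter m₆) h₄ s₅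
  have s₃ := le_real_inter_of_upper hc0 (by positivity) u₃ (u₄.inter (u₅.inter u₆)) m₃ (m₄.inter (m₅.inter m₆)) h₃ s₄
  have s₂ := le_real_inter_of_upper hc0 (by positivity) u₂ (u₃.inter (u₄.inter (u₅.inter u₆))) m₂
    (m₃.inter (m₄.inter (m₅.inter m₆))) h₂ s₃
  exact le_real_inter_of_upper hc0 (by positivity) u₁ (u₂.inter (u₃.inter (u₄.inter (u₅.inter u₆)))) m₁
    (m₂.inter (m₃.inter (m₄.inter (m₅.inter m₆)))) h₁ s₂

/-- **The `R⁺` extension events have probability `≥ c⁶`** (`c` the RSW constant at aspect ratio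
`256`; `64 ≤ m'`, `2m' ≤ m ≤ 4m'`). [cite: BollobasRiordan2006, Ch. 3, eq. (3)] -/
theorem le_real_inwardRpEvents (hc0 : 0 < c)
    (hc : ∀ l : ℕ, 1 ≤ l → c ≤ crossingProb half (256 * l - 1) (l - 1)) (hm' : 64 ≤ m') (h2 : 2 * m' ≤ m)
    (h4 : m ≤ 4 * m') :
    c ^ 6 ≤ (bondPercolation (zdGraph 2) half).real (inwardRpEvents m m') := by
  have ht : (((m / 4 : ℕ) : ℤ) + ((m / 64 : ℕ) : ℤ) - (((m' / 4 : ℕ) : ℤ) - ((m' / 64 : ℕ) : ℤ))).toNat ≤ 2 * m' := by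
    have h1 : m / 4 + m / 64 + m' / 64 ≤ 2 * m' := by omega
    have h1' : ((m / 4 : ℕ) : ℤ) + ((m / 64 : ℕ) : ℤ) + ((m' / 64 : ℕ) : ℤ) ≤ 2 * (m' : ℤ) := by exact_mod_cast h1
    have h0 : (0 : ℤ) ≤ (m' / 4 : ℕ) := by positivity
    refine Int.toNat_le.2 ?_
    simp only [Nat.cast_mul, Nat.cast_ofNat]
    linarith
  rw [inwardRpEvents]
  exact le_real_inter6_of_upper hc0.le (isUpperSet_lrCrossingAt _ _ _) (isUpperSet_tbCrossingAt' _ _ _)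
    (isUpperSet_lrCrossingAt _ _ _) (isUpperSet_lrCrossingAt _ _ _) (isUpperSet_tbCrossingAt' _ _ _)
    (isUpperSet_tbCrossingAt' _ _ _)
    (measurableSet_lrCrossingAt _ _ _) (measurableSet_tbCrossingAt' _ _ _) (measurableSet_lrCrossingAt _ _ _)
    (measurableSet_lrCrossingAt _ _ _) (measurableSet_tbCrossingAt' _ _ _) (measurableSet_tbCrossingAt' _ _ _)
    (le_real_lrCrossingAt_of_rsw_ratio hc _ (by omega)) (le_real_tbCrossingAt'_of_rsw_ratio hc _ (by omega))
    (le_real_lrCrossingAt_of_rsw_ratio hc _ (by omega)) (le_real_lrCrossingAt_of_rsw_ratio hc _ (by omega))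
    (le_real_tbCrossingAt'_of_rsw_ratio hc _ (by omega)) (le_real_tbCrossingAt'_of_rsw_ratio hc _ (by omega))

/-- **The `R⁻` extension events have probability `≥ c⁶`.** [cite: BollobasRiordan2006, Ch. 3, eq. (3)] -/
theorem le_real_inwardRmEvents (hc0 : 0 < c)
    (hc : ∀ l : ℕ, 1 ≤ l → c ≤ crossingProb half (256 * l - 1) (l - 1)) (hm' : 64 ≤ m') (h2 : 2 * m' ≤ m)
    (h4 : m ≤ 4 * m') :
    c ^ 6 ≤ (bondPercolation (zdGraph 2) half).real (inwardRmEvents m m') := by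
  have ht : ((-(((m' / 4 : ℕ) : ℤ) + ((m' / 64 : ℕ) : ℤ)) + 2 * ((m' / 64 : ℕ) : ℤ)) -
      (-(((m / 4 : ℕ) : ℤ) + ((m / 64 : ℕ) : ℤ)))).toNat ≤ 2 * m' := by
    have h1 : m / 4 + m / 64 + m' / 64 ≤ 2 * m' := by omega
    have h1' : ((m / 4 : ℕ) : ℤ) + ((m / 64 : ℕ) : ℤ) + ((m' / 64 : ℕ) : ℤ) ≤ 2 * (m' : ℤ) := by exact_mod_cast h1
    have h0 : (0 : ℤ) ≤ (m' / 4 : ℕ) := by positivity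
    refine Int.toNat_le.2 ?_
    simp only [Nat.cast_mul, Nat.cast_ofNat]
    linarith
  rw [inwardRmEvents]
  exact le_real_inter6_of_upper hc0.le (isUpperSet_lrCrossingAt _ _ _) (isUpperSet_tbCrossingAt' _ _ _)
    (isUpperSet_lrCrossingAt _ _ _) (isUpperSet_lrCrossingAt _ _ _) (isUpperSet_tbCrossingAt' _ _ _)
    (isUpperSet_tbCrossingAt' _ _ _)
    (measurableSet_lrCrossingAt _ _ _) (measurableSet_tbCrossingAt' _ _ _) (measurableSet_lrCrossingAt _ _ _)
    (measurableSet_lrCrossingAt _ _ _) (measurableSet_tbCrossingAt' _ _ _) (measurableSet_tbCrossingAt' _ _ _)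
    (le_real_lrCrossingAt_of_rsw_ratio hc _ (by omega)) (le_real_tbCrossingAt'_of_rsw_ratio hc _ (by omega))
    (le_real_lrCrossingAt_of_rsw_ratio hc _ (by omega)) (le_real_lrCrossingAt_of_rsw_ratio hc _ (by omega))
    (le_real_tbCrossingAt'_of_rsw_ratio hc _ (by omega)) (le_real_tbCrossingAt'_of_rsw_ratio hc _ (by omega))

end RSW

/-! ### The generalised FKG inequality and the extension cost -/

section Main

variable {m m' N : ℕ} {c : ℝ}

/-- **Inward extension of `zdFiveArmSepE`, the generalised FKG step**: for `64 ≤ m'`,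
`2m' ≤ m ≤ 4m'`, `2m ≤ N` and the RSW constant `c` at aspect ratio `256`,
`c²⁸ · P(zdFiveArmSepE m N) ≤ P(zdFiveArmSepE m N ∩ (extension events))`. [cite: Nolin2008, §4.3 Prop. 12 (i) and Lemma 13 (arXiv 0711.4948: Prop. 11 (i), Lemma 12)] [cite: KestenScalingCMP1987, §2 Lemma 5, (2.43)] -/
theorem real_zdFiveArmSepE_inter_inward_ge (hm' : 64 ≤ m') (h2 : 2 * m' ≤ m) (h4 : m ≤ 4 * m')
    (hN : 2 * m ≤ N) (hc0 : 0 < c) (hc : ∀ l : ℕ, 1 ≤ l → c ≤ crossingProb half (256 * l - 1) (l - 1)) :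
    c ^ 28 * (bondPercolation (zdGraph 2) half).real (zdFiveArmSepE m N) ≤
      (bondPercolation (zdGraph 2) half).real
        (zdFiveArmSepE m N ∩ ((inwardOpenEvents m m' ∩ (inwardRpEvents m m' ∩ inwardRmEvents m m')) ∩
          inwardDualEvents m m')) := by
  classical
  set μ := bondPercolation (zdGraph 2) half with hμ
  set P : Finset (Sym2 (Site 2)) := inwardOpenPairs m m' ∪ (inwardRpPairs m m' ∪ inwardRmPairs m m') with hP
  set M : Finset (Sym2 (Site 2)) := inwardDualPairs m m' with hM
  set Z : Set (Site 2) := zdSepZoneR m N ∪ zdSepZoneL m N ∪ (zdSepZoneT m N ∪ zdSepZoneB m N) with hZ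
  set ZS : Finset (Site 2) := (box 2 (N + N / 8 + 1)).filter (· ∈ Z) with hZS
  set S : Finset (Sym2 (Site 2)) := ZS.sym2 \ (P ∪ M) with hS
  have hSP : Disjoint S P := disjoint_sdiff_self_left.mono_right le_sup_left
  have hSM : Disjoint S M := disjoint_sdiff_self_left.mono_right le_sup_right
  have hPM : Disjoint P M := disjoint_inward5Pairs hm' h2
  have hZS_mem : ∀ x ∈ Z, x ∈ ZS := fun x hx => by
    rw [hZS, Finset.mem_filter]
    exact ⟨gl_zone_small_box (by omega) hN hx, hx⟩
  have hRL : (zdSepZoneR m N).sym2 ∪ (zdSepZoneL m N).sym2 ⊆ (↑S ∪ ↑P : Set (Sym2 (Site 2))) := by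
    intro e he
    have hz : ∀ x ∈ e, x ∈ zdSepZoneR m N ∪ zdSepZoneL m N := fun x hx => by
      rcases he with he | he
      · exact Or.inl (Set.mem_sym2_iff_subset.1 he hx)
      · exact Or.inr (Set.mem_sym2_iff_subset.1 he hx)
    by_cases heP : e ∈ P
    · exact Or.inr heP
    · left
      rw [Finset.mem_coe, hS, Finset.mem_sdiff, Finset.mem_union, Finset.mem_sym2_iff]
      refine ⟨fun x hx => hZS_mem x (Or.inl (hz x hx)), ?_⟩
      rintro (h | h)
      · exact heP h
      · obtain ⟨x, hx⟩ : ∃ x, x ∈ e := ⟨e.out.1, Sym2.out_fst_mem e⟩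
        exact notMem_zoneRL_of_dualSite hm' h2 hN (inwardDualPairs_sites hm' h2 h hx) (hz x hx)
  have hTB : (zdSepZoneT m N).sym2 ∪ (zdSepZoneB m N).sym2 ⊆ (↑S ∪ ↑M : Set (Sym2 (Site 2))) := by
    intro e he
    have hz : ∀ x ∈ e, x ∈ zdSepZoneT m N ∪ zdSepZoneB m N := fun x hx => by
      rcases he with he | he
      · exact Or.inl (Set.mem_sym2_iff_subset.1 he hx)
      · exact Or.inr (Set.mem_sym2_iff_subset.1 he hx)
    by_cases heM : e ∈ M
    · exact Or.inr heM
    · left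
      rw [Finset.mem_coe, hS, Finset.mem_sdiff, Finset.mem_union, Finset.mem_sym2_iff]
      refine ⟨fun x hx => hZS_mem x (Or.inr (hz x hx)), ?_⟩
      rintro (h | h)
      · obtain ⟨x, hx⟩ : ∃ x, x ∈ e := ⟨e.out.1, Sym2.out_fst_mem e⟩
        rw [hP, Finset.mem_union, Finset.mem_union] at h
        rcases h with h | h | h
        · exact notMem_zoneTB_of_openSite hm' h2 hN (inwardOpenPairs_sites hm' h2 h hx) (hz x hx)
        · have hs := inwardRpPairs_sites hm' h2 h hx
          have h0c : (0 : ℤ) ≤ (m' / 64 : ℕ) := by positivity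
          have h0d : (0 : ℤ) ≤ (m' / 4 : ℕ) := by positivity
          have h0e : ((m' / 64 : ℕ) : ℤ) ≤ (m' / 4 : ℕ) := by exact_mod_cast (by omega : m' / 64 ≤ m' / 4)
          exact notMem_zoneTB_of_extSite hm' h2 h4 hN ⟨hs.1, hs.2.1, abs_le.2 ⟨by linarith, hs.2.2.2⟩⟩ (hz x hx)
        · have hs := inwardRmPairs_sites hm' h2 h hx
          have h0c : (0 : ℤ) ≤ (m' / 64 : ℕ) := by positivity
          have h0e : ((m' / 64 : ℕ) : ℤ) ≤ (m' / 4 : ℕ) := by exact_mod_cast (by omega : m' / 64 ≤ m' / 4)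
          have h0f : (0 : ℤ) ≤ (m / 64 : ℕ) := by positivity
          have h0g : (0 : ℤ) ≤ (m / 4 : ℕ) := by positivity
          exact notMem_zoneTB_of_extSite hm' h2 h4 hN ⟨hs.1, hs.2.1, abs_le.2 ⟨by linarith, by linarith⟩⟩ (hz x hx)
      · exact heM h
  have dAp : DeterminedBy (zdSepOpenPairRE m N ∩ zdSepOpenArmL m N) (↑S ∪ ↑P) :=
    (determinedBy_zdSepOpenPairRE fun e he => hRL (Or.inl he)).inter
      (determinedBy_zdSepOpenArmL fun e he => hRL (Or.inr he))
  have dAm : DeterminedBy (zdSepDualArmT m N ∩ zdSepDualArmB m N) (↑S ∪ ↑M) :=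
    (determinedBy_zdSepDualArmT fun e he => hTB (Or.inl he)).inter
      (determinedBy_zdSepDualArmB fun e he => hTB (Or.inr he))
  have dBp : DeterminedBy (inwardOpenEvents m m' ∩ (inwardRpEvents m m' ∩ inwardRmEvents m m')) ↑P := by
    rw [hP]
    exact (determinedBy_inwardOpenEvents m m').inter_finsetUnion
      ((determinedBy_inwardRpEvents m m').inter_finsetUnion (determinedBy_inwardRmEvents m m'))
  have dBm : DeterminedBy (inwardDualEvents m m') ↑M := determinedBy_inwardDualEvents m m'
  have hFKG := bondPercolation_locallyMonotone_fkg (zdGraph 2) half hSP hSM hPM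
    (isUpperSet_zdSepOpenPairRE_inter_zdSepOpenArmL m N)
    ((isLowerSet_zdSepDualArmT _ _).inter (isLowerSet_zdSepDualArmB _ _))
    ((isUpperSet_inwardOpenEvents m m').inter ((isUpperSet_inwardRpEvents m m').inter (isUpperSet_inwardRmEvents m m')))
    (isLowerSet_inwardDualEvents m m') dAp dAm dBp dBm
  have hBo := le_real_inwardOpenEvents hc0 hc hm' h4
  have hBrp := le_real_inwardRpEvents hc0 hc hm' h2 h4
  have hBrm := le_real_inwardRmEvents hc0 hc hm' h2 h4
  have hBm := le_real_inwardDualEvents hc0 hc hm' h4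
  have hBrr : c ^ 6 * c ^ 6 ≤ μ.real (inwardRpEvents m m' ∩ inwardRmEvents m m') :=
    le_real_inter_of_upper (by positivity) (by positivity) (isUpperSet_inwardRpEvents m m') (isUpperSet_inwardRmEvents m m')
      (measurableSet_inwardRpEvents m m') (measurableSet_inwardRmEvents m m') hBrp hBrm
  have hBp : c ^ 8 * (c ^ 6 * c ^ 6) ≤ μ.real (inwardOpenEvents m m' ∩ (inwardRpEvents m m' ∩ inwardRmEvents m m')) :=
    le_real_inter_of_upper (by positivity) (by positivity) (isUpperSet_inwardOpenEvents m m')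
      ((isUpperSet_inwardRpEvents m m').inter (isUpperSet_inwardRmEvents m m'))
      (measurableSet_inwardOpenEvents m m')
      ((measurableSet_inwardRpEvents m m').inter (measurableSet_inwardRmEvents m m')) hBo hBrr
  have hset : zdSepOpenPairRE m N ∩ zdSepOpenArmL m N ∩ (zdSepDualArmT m N ∩ zdSepDualArmB m N) =
      zdFiveArmSepE m N := rfl
  rw [hset] at hFKG
  calc c ^ 28 * μ.real (zdFiveArmSepE m N)
      = μ.real (zdFiveArmSepE m N) * ((c ^ 8 * (c ^ 6 * c ^ 6)) * c ^ 8) := by ring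
    _ ≤ μ.real (zdFiveArmSepE m N) *
        (μ.real (inwardOpenEvents m m' ∩ (inwardRpEvents m m' ∩ inwardRmEvents m m')) * μ.real (inwardDualEvents m m')) :=
        mul_le_mul_of_nonneg_left (mul_le_mul hBp hBm (by positivity) measureReal_nonneg) measureReal_nonneg
    _ ≤ _ := hFKG

/-- **Inward extension of the well-separated five-arm event**:
`c²⁸ · P(zdFiveArmSepE m N) ≤ P(zdFiveArmSepE m' N)` for `64 ≤ m'`, `2m' ≤ m ≤ 4m'`, `2m ≤ N`, `c` the RSW
constant at aspect ratio `256`. [cite: Nolin2008, §4.3 Prop. 12 (i) and §4.4 part 2 (arXiv 0711.4948: Prop. 11 (i), p. 13)] [cite: KestenScalingCMP1987, §2 Lemma 5] -/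
theorem real_zdFiveArmSepE_inward_ge (hm' : 64 ≤ m') (h2 : 2 * m' ≤ m) (h4 : m ≤ 4 * m')
    (hN : 2 * m ≤ N) (hc0 : 0 < c) (hc : ∀ l : ℕ, 1 ≤ l → c ≤ crossingProb half (256 * l - 1) (l - 1)) :
    c ^ 28 * (bondPercolation (zdGraph 2) half).real (zdFiveArmSepE m N) ≤
      (bondPercolation (zdGraph 2) half).real (zdFiveArmSepE m' N) := by
  refine (real_zdFiveArmSepE_inter_inward_ge hm' h2 h4 hN hc0 hc).trans ?_
  refine ENNReal.toReal_mono (measure_ne_top _ _) (measure_mono_ae ?_)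
  have hae : ∀ᵐ ω ∂(bondPercolation (zdGraph 2) half), ω ⊆ (zdGraph 2).edgeSet :=
    ProbabilityTheory.setBernoulli_ae_subset
  filter_upwards [hae] with ω hω h
  exact mem_zdFiveArmSepE_of_mem_inward5 hω hm' h2 h4 hN h

/-- **Extension cost of `zdFiveArmSepE` at halved inner radius**, packaged: there is `C₀ ≥ 1` with
`P(zdFiveArmSepE m N) ≤ C₀ · P(zdFiveArmSepE m' N)` whenever `64 ≤ m'`, `2m' ≤ m ≤ 4m'`, `2m ≤ N` — the
input `(ext)` of `DuminilCopinManolescuTassion2021_zdFiveArm_upperBound_of_separationInputs`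
(`n₁ = 64`). [cite: Nolin2008, §4.4 part 2 (arXiv 0711.4948 p. 13: "going from ∂S_m to ∂S_{2m} has a cost C'₀ depending only on η'₀")] -/
theorem exists_real_zdFiveArmSepE_le_mul_inward :
    ∃ C₀ : ℝ, 1 ≤ C₀ ∧ ∀ m m' N : ℕ, 64 ≤ m' → 2 * m' ≤ m → m ≤ 4 * m' → 2 * m ≤ N →
      (bondPercolation (zdGraph 2) half).real (zdFiveArmSepE m N) ≤
        C₀ * (bondPercolation (zdGraph 2) half).real (zdFiveArmSepE m' N) := by
  obtain ⟨c, hc0, hc⟩ := rsw_lowerBound_holds 256 (by norm_num)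
  refine ⟨max 1 (c ^ 28)⁻¹, le_max_left _ _, fun m m' N hm' h2 h4 hN => ?_⟩
  have h := real_zdFiveArmSepE_inward_ge hm' h2 h4 hN hc0 hc
  have hc28 : 0 < c ^ 28 := by positivity
  calc (bondPercolation (zdGraph 2) half).real (zdFiveArmSepE m N)
      = (c ^ 28)⁻¹ * (c ^ 28 * (bondPercolation (zdGraph 2) half).real (zdFiveArmSepE m N)) := by
        field_simp
    _ ≤ (c ^ 28)⁻¹ * (bondPercolation (zdGraph 2) half).real (zdFiveArmSepE m' N) :=
        mul_le_mul_of_nonneg_left h (by positivity)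
    _ ≤ max 1 (c ^ 28)⁻¹ * (bondPercolation (zdGraph 2) half).real (zdFiveArmSepE m' N) :=
        mul_le_mul_of_nonneg_right (le_max_right _ _) measureReal_nonneg

end Main

end Literature.Probability.Percolation
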